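import Summits.Schanuel.Schanuel.Theorems.DiophantineDichotomyKhovanskiiApproxTypeEvRareFieldDefs
import Summits.Schanuel.Schanuel.Theorems.EPiSimultaneousType.Negative.CoordinatewiseLinear
import HarnessLib

/-!
# Stub `stub_balancedOfDhY` of line `rare-field-species` — crux `KhovanskiiApproxTypeEv`
# (stmt-Schanuel-14972): THE BALANCED CLASS `BalancedOfDhY`

Route `DiophantineDichotomy` (sub-problem `Schanuel/Schanuel`), line lead
`prover-line-stmt-Schanuel-14972-a4-0`, support skeleton
`Cruxes/KhovanskiiApproxTypeEv/Lines/rare_field_species.lean`, vocabulary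
`Theorems/DiophantineDichotomyKhovanskiiApproxTypeEvRareFieldDefs.lean` (p136201).

`BalancedOfDhY`: a `(d,h)`-currency eventual approximation type `ApproxTypeDhEvYAt n s p C` at
`θ = (s, e^s) ∈ ℂ²ⁿ` (`n ≥ 1`) gives the NAIVE typed bound `exp(−C d^{p−x} log H) ≤ ‖γ − θ‖` — same
`C`, same thresholds `H₀(d)` — for the "balanced" challengers `γ` of level `(d, H)`, i.e. those all of
whose `y`-coordinates `γ (inr j)` have degree `≥ dˣ` over `ℚ`.  It feeds the composition
`evLWBalanced_of` (the naive Lindemann–Weierstrass layer on balanced challengers at every rank).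

Proof: given `d` take the SAME threshold `H₀(d)`; given `H, γ` put `m := min_j deg_ℚ(γ (inr j))`
(`Finset.exists_min_image` on the non-empty `Finset.univ : Finset (Fin n)`).  Then `1 ≤ m`
(`minpoly.natDegree_pos`, integrality from the clause) and `m ≤ [ℚ(γ (inr j₀)):ℚ] ≤ d`
(`IntermediateField.adjoin.finrank`, `EPiSimultaneousType.finrank_adjoin_simple_le_of_clause`), every
`y`-degree is `≥ m` by minimality, so the hypothesis gives `exp(−C dᵖ log H / m) ≤ ‖γ − θ‖`; finally
`dˣ ≤ m`, `C > 0`, `log H ≥ 0` give `C dᵖ log H / m ≤ C d^{p−x} log H` (`dᵖ = d^{p−x} dˣ`,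
`Real.rpow_add`), and `Real.exp` is monotone.
-/

noncomputable section

-- `Summit.Schanuel.Schanuel.…` is the mandated summit/sub-problem namespace (single-conjunct summit), hence:
set_option linter.dupNamespace false

namespace Summit.Schanuel.Schanuel.Cruxes.KhovanskiiApproxTypeEv.RareFieldSpecies

open Summit.Schanuel.Schanuel.Theorems.EPiSimultaneousType (finrank_adjoin_simple_le_of_clause)

/-- THE REAL-ANALYSIS TAIL of `BalancedOfDhY`: for `C ≥ 0`, `L ≥ 0`, `0 < d`, `0 < m` and
`dˣ ≤ m`, `C dᵖ L / m ≤ C d^{p−x} L`. [folklore] -/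
theorem dhBound_le_balancedBound {C p x d m L : ℝ} (hC : 0 ≤ C) (hL : 0 ≤ L) (hd : 0 < d)
    (hm : 0 < m) (hxm : d ^ x ≤ m) : C * d ^ p * L / m ≤ C * d ^ (p - x) * L := by
  rw [div_le_iff₀ hm]
  have hsplit : d ^ p = d ^ (p - x) * d ^ x := by
    rw [← Real.rpow_add hd, sub_add_cancel]
  have h0 : 0 ≤ C * d ^ (p - x) * L := mul_nonneg (mul_nonneg hC (Real.rpow_nonneg hd.le _)) hL
  calc C * d ^ p * L = (C * d ^ (p - x) * L) * d ^ x := by rw [hsplit]; ring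
    _ ≤ (C * d ^ (p - x) * L) * m := mul_le_mul_of_nonneg_left hxm h0

/-- **Stub `stub_balancedOfDhY`** (registered on stmt-Schanuel-14972, line `rare-field-species`):
a `(d,h)`-currency eventual type `(p, C)` at `θ = (s, e^s)` gives the naive typed bound
`exp(−C d^{p−x} log H) ≤ ‖γ − θ‖` (same `C`, same thresholds) on the balanced challengers, those all
of whose `y`-coordinates have degree `≥ dˣ` over `ℚ`: apply the hypothesis with
`m := min_j deg_ℚ(γ (inr j))` (`1 ≤ m ≤ d` from the clause) and use `dˣ ≤ m`. [folklore] -/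
theorem stub_balancedOfDhY : BalancedOfDhY := by
  intro n s p C x hn h d
  obtain ⟨hC, hall⟩ := h
  obtain ⟨H₀, hH₀⟩ := hall d
  refine ⟨H₀, fun H γ hH hfr hpoly hdeg => ?_⟩
  -- the minimising `y`-coordinate
  obtain ⟨j₀, -, hmin⟩ := Finset.exists_min_image Finset.univ
    (fun j : Fin n => (minpoly ℚ (γ (Sum.inr j))).natDegree) ⟨⟨0, hn⟩, Finset.mem_univ _⟩
  obtain ⟨hint, hfr₀⟩ := finrank_adjoin_simple_le_of_clause (hpoly (Sum.inr j₀))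
  set m : ℕ := (minpoly ℚ (γ (Sum.inr j₀))).natDegree with hm
  have hm1 : 1 ≤ m := minpoly.natDegree_pos hint
  have hmd : m ≤ d := by
    rw [hm, ← IntermediateField.adjoin.finrank hint]
    exact hfr₀
  -- the `(d,h)`-currency bound at `m`
  have hbound : Real.exp (-(C * (d : ℝ) ^ p * Real.log H / m)) ≤
      ‖γ - Sum.elim s (Complex.exp ∘ s)‖ :=
    hH₀ H m γ hH hm1 hmd hfr hpoly fun j => hmin j (Finset.mem_univ j)
  -- the real-analysis tail
  have hd0 : (0 : ℝ) < d := by exact_mod_cast hm1.trans hmd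
  have hm0 : (0 : ℝ) < m := by exact_mod_cast hm1
  have hxm : (d : ℝ) ^ x ≤ (m : ℝ) := hdeg j₀
  have key : C * (d : ℝ) ^ p * Real.log H / m ≤ C * (d : ℝ) ^ (p - x) * Real.log H :=
    dhBound_le_balancedBound hC.le (Real.log_natCast_nonneg H) hd0 hm0 hxm
  exact (Real.exp_le_exp.2 (neg_le_neg key)).trans hbound

end Summit.Schanuel.Schanuel.Cruxes.KhovanskiiApproxTypeEv.RareFieldSpecies

end
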